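import Summits.KontsevichZagierPeriods.KontsevichZagierPeriods.Theorems.RootDecompZetaThreeFrontierRungFourPreludeP13

/-! # `RootDecompZetaThreeFrontierRungFourPreludeP14` — part 14/14 of the mechanical ≤400-line split of `pre_src.lean` (sha256 ba362a5194d75c20…)
Source: decomp-kz lens-1 g12/g13 rung-4 prelude = Prelude_v3.lean @ba362a51 (Basis22_v1 sections RotFour/Shuffle/ProdFour/GenFb/WordMoves/RungFour/Basis22 + FacetGeneric_v2 §1–§23; critic CLEARED g6 row 330 / g6-20 l.1368); --supports stmt-KontsevichZagierPeriods-27141.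
Split by census-1 g10 `gen/splitlean.py`: scopes re-opened with their `open`/`variable`/`set_option` context; mathematics and declaration order unchanged. -/

set_option linter.dupNamespace false
open MeasureTheory Set
open Literature.NumberTheory.Transcendental
set_option linter.dupNamespace false
namespace Summit.KontsevichZagierPeriods.KontsevichZagierPeriods.Cruxes.GZNormalFormWThree.GZLadder.RungFour
open Summit.KontsevichZagierPeriods.KontsevichZagierPeriods.Cruxes.GZNormalFormWThree.GZLadder.FacetFour
  (not_integrableOn_of_residue)
section Evaluate
variable {M : ℕ}
set_option linter.unusedSimpArgs false

/-- Auxiliary step `xpt_mapT_insT_zero`: xpt map T ins T zero. [bookkeeping] -/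
theorem xpt_mapT_insT_zero (j : Fin (M + 1)) (x : Fin M → ℝ) (l : Fin (M + 3)) :
    xpt (M + 1) (mapT j (Fin.insertNth j 0 x)) l = ptT0 j x l := by
  rw [xpt_mapT_insT]
  unfold ptT0
  by_cases h0 : (l : ℕ) = 0
  · rw [dif_pos h0, dif_pos h0]
  rw [dif_neg h0, dif_neg h0]
  by_cases h1 : (l : ℕ) ≤ j
  · rw [dif_pos h1, dif_pos h1]
  rw [dif_neg h1, dif_neg h1]
  split_ifs <;> simp

/-- **`redT` at `ε = 0`**: cluster chords (`j+1 ≤ c.i`) give `ylabT c.i − ylabT c.j`, the others the collapsed form -/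
theorem redT_zero (j : Fin (M + 1)) (c : Chord (M + 1)) (x : Fin M → ℝ) :
    redT j c (x, 0) = if (j : ℕ) + 1 ≤ c.i then ylabT j x c.i - ylabT j x c.j else ptT0 j x c.i - ptT0 j x c.j := by
  unfold redT
  split_ifs with h
  · rfl
  · simp only [Chord.form, xpt_mapT_insT_zero]

/-- the collapsed points on the run facet `t_a = … = t_b` -/
def ptR0 (a b : Fin (M + 1)) (x : Fin M → ℝ) (l : Fin (M + 3)) : ℝ :=
  if (l : ℕ) = 0 then 1
  else if h1 : (l : ℕ) ≤ a + 1 ∧ (l : ℕ) - 1 < M then x ⟨(l : ℕ) - 1, h1.2⟩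
  else if (l : ℕ) ≤ b + 1 then topR a x
  else if h4 : (l : ℕ) ≤ M + 1 ∧ (l : ℕ) - 2 < M then x ⟨(l : ℕ) - 2, h4.2⟩
  else 0

/-- Auxiliary step `xpt_mapR_insR_zero`: xpt map R ins R zero. [bookkeeping] -/
theorem xpt_mapR_insR_zero {a b : Fin (M + 1)} (hab : (a : ℕ) < b) (x : Fin M → ℝ) (l : Fin (M + 3)) :
    xpt (M + 1) (mapR a b (Fin.insertNth b 0 x)) l = ptR0 a b x l := by
  have hb := b.isLt
  rw [xpt_mapR_insR hab]
  unfold ptR0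
  by_cases h0 : (l : ℕ) = 0
  · rw [dif_pos h0, if_pos h0]
  rw [dif_neg h0, if_neg h0]
  by_cases h1 : (l : ℕ) ≤ a + 1
  · rw [dif_pos h1, dif_pos ⟨h1, by omega⟩]
  rw [dif_neg h1, dif_neg (show ¬ ((l : ℕ) ≤ a + 1 ∧ (l : ℕ) - 1 < M) by omega)]
  by_cases h2 : (l : ℕ) ≤ b
  · rw [dif_pos h2, if_pos (show (l : ℕ) ≤ b + 1 by omega), zero_mul, sub_zero]
  rw [dif_neg h2]
  by_cases h3 : (l : ℕ) = b + 1
  · rw [dif_pos h3, if_pos (show (l : ℕ) ≤ b + 1 by omega), sub_zero]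
  rw [dif_neg h3, if_neg (show ¬ ((l : ℕ) ≤ b + 1) by omega)]
  by_cases h4 : (l : ℕ) ≤ M + 1
  · rw [dif_pos h4, dif_pos (show (l : ℕ) ≤ M + 1 ∧ (l : ℕ) - 2 < M from ⟨h4, by omega⟩)]
  · rw [dif_neg h4, dif_neg (show ¬ ((l : ℕ) ≤ M + 1 ∧ (l : ℕ) - 2 < M) by omega)]

/-- **`redR` at `ε = 0`**: cluster chords give `slab c.j − slab c.i`, the others the collapsed form -/
theorem redR_zero {a b : Fin (M + 1)} (hab : (a : ℕ) < b) (c : Chord (M + 1)) (x : Fin M → ℝ) :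
    redR a b c (x, 0) =
      if (a : ℕ) + 1 ≤ c.i ∧ (c.j : ℕ) ≤ b + 1 then slab a b x c.j - slab a b x c.i
      else ptR0 a b x c.i - ptR0 a b x c.j := by
  unfold redR
  split_ifs with h
  · rfl
  · simp only [Chord.form, xpt_mapR_insR_zero hab]

open Classical in
/-- the tail residue, unfolded -/
theorem resT_eq (j : Fin (M + 1)) (F : Finset (Fin (M + 1) → Chord (M + 1))) (q : (Fin (M + 1) → Chord (M + 1)) → ℚ)
    (x : Fin M → ℝ) :
    resT j F q x = ∑ S ∈ F, if nT j S = tailCard j + 1 then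
      (q S : ℝ) * ∏ m, 1 / (if (j : ℕ) + 1 ≤ (S m).i then ylabT j x (S m).i - ylabT j x (S m).j
        else ptT0 j x (S m).i - ptT0 j x (S m).j) else 0 := by
  unfold resT
  simp only [redT_zero]

open Classical in
/-- the run residue, unfolded -/
theorem resR_eq {a b : Fin (M + 1)} (hab : (a : ℕ) < b) (F : Finset (Fin (M + 1) → Chord (M + 1)))
    (q : (Fin (M + 1) → Chord (M + 1)) → ℚ) (x : Fin M → ℝ) :
    resR a b F q x = ∑ S ∈ F, if nR a b S = runInt a b + 1 then
      (q S : ℝ) * ∏ m, 1 / (if (a : ℕ) + 1 ≤ (S m).i ∧ ((S m).j : ℕ) ≤ b + 1 then slab a b x (S m).j - slab a b x (S m).i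
        else ptR0 a b x (S m).i - ptR0 a b x (S m).j) else 0 := by
  unfold resR
  simp only [redR_zero hab]

end Evaluate

end Summit.KontsevichZagierPeriods.KontsevichZagierPeriods.Cruxes.GZNormalFormWThree.GZLadder.RungFour
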